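import Summits.FinalStateConjecture.FinalStateConjecture.Theses.ExactKerrEnds
import Literature.Geometry.Lorentzian.ExactKerrEnd

/-!
# Line `kerr-ended-attraction` for the crux `ExactKerrEnds.SettlingAlongCensoredKerrEnds`
# (stmt-FinalStateConjecture-18520) — global attraction in C⁰ ∧ relative third-law kick ∧ redshift
# upgrade, TRANSFERRED TO THE KERR-ENDED CLASS, ⇒ C₂

Crux-strategist before the lead (unit `cstrat-stmt-FinalStateConjecture-18520-b1`, 2026-08-17).

The crux C₂ = `SettlingAlongCensoredKerrEnds` is the relative hypothesis `hrel` of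
`InitialDataSet.isTameChristodoulouGeneric_of_relative'` with `Q := KerrEnded ∧ Censored` and
`P := Settled` (the full settling clause of the Statement for every MGHD). As ONE statement it is the
settling half of the summit on the Kerr-ended class (grounders/refuter: open-problem). This skeleton
is the TRANSFER of the sibling route `GlobalAttraction`'s proved cut (`CensoredExteriorsSettle` ∧
`GenericCensorshipThirdLaw` ∧ `SubextremalUpgrade` ⇒ summit, `closes` of that route) to the
Kerr-ended class and to the RELATIVE form this route composes with:

* `stub_kerrEndedCensoredSettleC0` (X₁, pointwise, C⁰, closed spin range): every maximal vacuum Cauchy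
  development with complete 𝓘⁺ of a KERR-ENDED admissible datum settles HONESTLY in C⁰ — an `N`-hole
  `FinalStateDecomposition … O 0` (its structure allows `|aᵢ| ≤ Mᵢ`, so extremal members of the
  attractor are not counterexamples) with `O = exteriorOf`, `RaysStayInClosure`, `HasExhaustiveCharts`,
  `IsFutureOriented`. = `GlobalAttraction.CensoredExteriorsSettle` (stmt-17296) RESTRICTED to
  Kerr-ended data: strictly weaker, and every member analysed has an exactly Kerr far field
  (support `ExactKerrFarDevelopment`, stmt-18523), so the far-field pathologies of the admissible class
  (Negative/FarFieldFocusing of `StationaryLimitReduction`) never enter.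
* `stub_thirdLawKickAlongCensoredKerrEnds` (K, relative, NO settling conclusion): along every tame
  curve of admissible data whose members off `0` are Kerr-ended and censored there is a tame, injective,
  immersed admissible curve through the same base datum whose members off `0` are Kerr-ended, censored
  AND obey the C⁰ THIRD LAW in existential form: every MGHD that admits an honest C⁰ decomposition at
  all admits one with SUB-extremal holes `|aᵢ| < Mᵢ`. (Censorship is given on the input curve and must
  only be PRESERVED by the kick — weaker than `GlobalAttraction.GenericCensorshipThirdLaw`, which
  contains weak cosmic censorship itself; the existential form dodges the "spurious extremal chart"
  rigidity risk of the ∀-form.)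
* `stub_kerrEndedRedshiftUpgrade` (U, pointwise, Kerr-ended): an honest C⁰ decomposition with
  sub-extremal holes of a censored MGHD of a KERR-ENDED admissible datum upgrades to an honest C²
  decomposition with sub-extremal holes. = `GlobalAttraction.SubextremalUpgrade` (stmt-17298)
  RESTRICTED to Kerr-ended data. The restriction is the point: the unrestricted pointwise C⁰ → C²
  upgrade over `admissibleVacuumData` is refutable in kind by DR-small far-field focusing trains
  (`focusing_exponents`, `not_tendsto_deviationCk_of_frequently_le` in
  `Theorems/StationaryLimitReduction/Negative/FarFieldFocusing.lean`: C⁰ size → 0, focal C² size → ∞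
  arbitrarily late); exact Kerr ends carry no incoming trains.
* `SettlingAlongCensoredKerrEnds_of_stubs : X₁ → K → U → ExactKerrEnds.SettlingAlongCensoredKerrEnds` —
  PROVED, placeholder-free, and `SettlingAlongCensoredKerrEnds_of : <the crux>` = it applied to the three
  registered stubs (the sibling's `closes` logic run along the kicked curve: K hands back the
  curve; for each member off `0` and each MGHD, censorship gives complete 𝓘⁺, X₁ an honest C⁰
  decomposition, the third law a sub-extremal one, U the honest C² one the Statement asks for).

Disproof used: no `Cruxes/SettlingAlongCensoredKerrEnds/Disproof.lean` exists yet (no `_false_without_`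
obstruction to honour); negatives index: 1 entry (`not_UniformPhotonSphereChannels`), unrelated; the
Negative lemmas consulted are `StationaryLimitReduction/Negative/FarFieldFocusing` (dodged by the
Kerr-ended restriction, above) and `TameCensorship/Negative/*` (tame genericity not ∧-closed — honoured:
the third law enters RELATIVELY, along curves, never by conjunction).
-/

noncomputable section

set_option linter.dupNamespace false

open Set Function Filter Topology TopologicalSpace
open scoped ENNReal Topology Manifold ContDiff
open Literature.Geometry.Lorentzian

namespace Summit.FinalStateConjecture.FinalStateConjecture.Cruxes.SettlingAlongCensoredKerrEnds.KerrEndedAttraction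

/-! ### The three registered stubs -/

/-- **Stub X₁ — Kerr-ended censored developments settle honestly in C⁰ (closed spin range).**
For every `X`, every admissible datum `D` with an exact Kerr end (`InitialDataSet.HasExactKerrEnd`,
= the let-bound legend `KerrEnded` of the route by `hasExactKerrEnd_iff`), and every maximal vacuum
Cauchy development `𝒟` of `D` with complete future null infinity, there are a region `O` and a C⁰
final-state decomposition `d` of `O` (finitely many boosted Kerr holes with `0 < Mᵢ`, `|aᵢ| ≤ Mᵢ`,
plus a flat radiation chart) with `O = exteriorOf 𝒟 d.charted`, `RaysStayInClosure 𝒟 O`,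
`HasExhaustiveCharts d` and `IsFutureOriented d`. Komech-type global attraction for compactly supported
(large) deviations from an exact Kerr end; `GlobalAttraction.CensoredExteriorsSettle` restricted to the
Kerr-ended class. Open-problem sized (capture + C⁰ endgame), but POINTWISE: no curves, no genericity,
no tameness, and no far-field tail/focusing bookkeeping. -/
theorem stub_kerrEndedCensoredSettleC0 :
    ∀ (X : Type) [TopologicalSpace X] [ChartedSpace E3 X] [IsManifold (𝓡 3) ∞ X] [T2Space X]
      [SecondCountableTopology X] [ConnectedSpace X],
      ∀ D ∈ admissibleVacuumData X, D.HasExactKerrEnd →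
        ∀ 𝒟 : VacuumCauchyDevelopment D, 𝒟.IsMaximal →
          Summit.FinalStateConjecture.HasCompleteNullInfinity 𝒟.toCauchyDevelopment →
            ∃ (O : Set 𝒟.carrier) (d : FinalStateDecomposition 𝒟.toSpacetime O 0),
              O = Summit.FinalStateConjecture.exteriorOf 𝒟.toCauchyDevelopment d.charted ∧
                Summit.FinalStateConjecture.RaysStayInClosure 𝒟.toCauchyDevelopment O ∧
                  Summit.FinalStateConjecture.HasExhaustiveCharts d ∧
                    Summit.FinalStateConjecture.IsFutureOriented d := by
  sorry

/-- **Stub K — the relative third-law kick along censored Kerr-ended curves (censorship-preserving,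
no settling conclusion).** For every `X`, end `e` and tame curve `F` of admissible data on `e`,
immersed-injective or constant, whose members off `0` are Kerr-ended and censored (every MGHD has
complete 𝓘⁺), there are an end `e'` and a tame, injective, immersed curve `F'` of admissible data
with `F' 0 = F 0` whose members off `0` are Kerr-ended, censored, and satisfy the C⁰ THIRD LAW in
existential form: for every MGHD, if SOME honest C⁰ final-state decomposition exists then one exists
all of whose holes are SUB-extremal, `|aᵢ| < Mᵢ`. Content: (i) extremal members of the attractor are
reached only from positive tame codimension inside the Kerr-ended class (Kehle–Unger / Angelopoulos–
Kehle–Unger: extremal formation is a codimension-one critical phenomenon) — the kick is a compactly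
supported modification pushing the final spin-to-mass ratio off `1`, chosen smoothly along the curve;
(ii) censorship and Kerr-endedness survive the kick (Kerr-endedness: `HasExactKerrEnd.of_eq_off_compact`;
censorship: the substantive part). In the constant case at a datum already obeying the third law the
breathing curve `TameBreathingCurve.exists_tame_selfWitness` serves once the three properties are shown
invariant under "isometric copy agreeing off a compact set". Open-problem sized (a vacuum third law in
transversality form), but it asks for NO settling. -/
theorem stub_thirdLawKickAlongCensoredKerrEnds :
    ∀ (X : Type) [TopologicalSpace X] [ChartedSpace E3 X] [IsManifold (𝓡 3) ∞ X] [T2Space X]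
      [SecondCountableTopology X] [ConnectedSpace X],
      ∀ (e : AFEnd X) (F : EuclideanSpace ℝ (Fin 1) → InitialDataSet (𝓡 3) X),
        InitialDataSet.IsTameDataFamily e 1 F →
          ((InitialDataSet.IsImmersedAtZero 1 F ∧ Injective F) ∨ ∀ c, F c = F 0) →
            (∀ c, F c ∈ admissibleVacuumData X) →
              (∀ c ≠ 0, (F c).HasExactKerrEnd ∧
                ∀ 𝒟 : VacuumCauchyDevelopment (F c), 𝒟.IsMaximal →
                  Summit.FinalStateConjecture.HasCompleteNullInfinity 𝒟.toCauchyDevelopment) →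
                ∃ (e' : AFEnd X) (F' : EuclideanSpace ℝ (Fin 1) → InitialDataSet (𝓡 3) X),
                  InitialDataSet.IsTameDataFamily e' 1 F' ∧ F' 0 = F 0 ∧ Injective F' ∧
                    InitialDataSet.IsImmersedAtZero 1 F' ∧
                    (∀ c, F' c ∈ admissibleVacuumData X) ∧
                    ∀ c ≠ 0, (F' c).HasExactKerrEnd ∧
                      (∀ 𝒟 : VacuumCauchyDevelopment (F' c), 𝒟.IsMaximal →
                        Summit.FinalStateConjecture.HasCompleteNullInfinity 𝒟.toCauchyDevelopment) ∧
                      ∀ 𝒟 : VacuumCauchyDevelopment (F' c), 𝒟.IsMaximal →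
                        (∃ (O : Set 𝒟.carrier) (d : FinalStateDecomposition 𝒟.toSpacetime O 0),
                          O = Summit.FinalStateConjecture.exteriorOf 𝒟.toCauchyDevelopment d.charted ∧
                            Summit.FinalStateConjecture.RaysStayInClosure 𝒟.toCauchyDevelopment O ∧
                              Summit.FinalStateConjecture.HasExhaustiveCharts d ∧
                                Summit.FinalStateConjecture.IsFutureOriented d) →
                          ∃ (O : Set 𝒟.carrier) (d : FinalStateDecomposition 𝒟.toSpacetime O 0),
                            (∀ i, Kerr.IsSubextremal (d.mass i) (d.spin i)) ∧
                            O = Summit.FinalStateConjecture.exteriorOf 𝒟.toCauchyDevelopment d.charted ∧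
                              Summit.FinalStateConjecture.RaysStayInClosure 𝒟.toCauchyDevelopment O ∧
                                Summit.FinalStateConjecture.HasExhaustiveCharts d ∧
                                  Summit.FinalStateConjecture.IsFutureOriented d := by
  sorry

/-- **Stub U — redshift upgrade C⁰ → C² for Kerr-ended data (pointwise).** For every `X`, every
Kerr-ended admissible `D`, every maximal vacuum Cauchy development `𝒟` of `D` with complete 𝓘⁺, and
every honest C⁰ final-state decomposition `d₀` of a region `O` (`O = exteriorOf`, `RaysStayInClosure`,
`HasExhaustiveCharts`, `IsFutureOriented`) all of whose holes are sub-extremal, there are a region `O'`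
and an honest C² final-state decomposition `d` of `O'` with sub-extremal holes. =
`GlobalAttraction.SubextremalUpgrade` restricted to the Kerr-ended class, where it is NOT exposed to
DR-small far-field focusing trains (`FarFieldFocusing.focusing_exponents`: over all admissible data the
pointwise C² conclusion fails one derivative short of the class's control; an exact Kerr end carries no
incoming train). Content: the two derivatives the Aretakis instability forbids at extremality are
recovered from the redshift of sub-extremal horizons, integrated local energy decay on a background
C⁰-exhaustively close to sub-extremal multi-Kerr, and the smoothness + exact Kerr far field of the
datum; the charts may be rebuilt. L/XL. -/
theorem stub_kerrEndedRedshiftUpgrade :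
    ∀ (X : Type) [TopologicalSpace X] [ChartedSpace E3 X] [IsManifold (𝓡 3) ∞ X] [T2Space X]
      [SecondCountableTopology X] [ConnectedSpace X],
      ∀ D ∈ admissibleVacuumData X, D.HasExactKerrEnd →
        ∀ 𝒟 : VacuumCauchyDevelopment D, 𝒟.IsMaximal →
          Summit.FinalStateConjecture.HasCompleteNullInfinity 𝒟.toCauchyDevelopment →
            ∀ (O : Set 𝒟.carrier) (d₀ : FinalStateDecomposition 𝒟.toSpacetime O 0),
              O = Summit.FinalStateConjecture.exteriorOf 𝒟.toCauchyDevelopment d₀.charted →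
                Summit.FinalStateConjecture.RaysStayInClosure 𝒟.toCauchyDevelopment O →
                  Summit.FinalStateConjecture.HasExhaustiveCharts d₀ →
                    Summit.FinalStateConjecture.IsFutureOriented d₀ →
                      (∀ i, Kerr.IsSubextremal (d₀.mass i) (d₀.spin i)) →
                        ∃ (O' : Set 𝒟.carrier) (d : FinalStateDecomposition 𝒟.toSpacetime O' 2),
                          (∀ i, Kerr.IsSubextremal (d.mass i) (d.spin i)) ∧
                            O' = Summit.FinalStateConjecture.exteriorOf 𝒟.toCauchyDevelopment d.charted ∧
                              Summit.FinalStateConjecture.RaysStayInClosure 𝒟.toCauchyDevelopment O' ∧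
                                Summit.FinalStateConjecture.HasExhaustiveCharts d ∧
                                  Summit.FinalStateConjecture.IsFutureOriented d := by
  sorry

/-! ### The composition (proved): X₁ → K → U → C₂ -/

/-- **The composition, hypothesis form** (Theses-free shape, for a Theorems landing). Given the three stubs, `SettlingAlongCensoredKerrEnds`
holds: along a censored Kerr-ended curve `F`, the kick K hands back `F'` (tame, injective, immersed,
admissible, `F' 0 = F 0`) whose members off `0` are Kerr-ended, censored and obey the C⁰ third law; for
such a member and any MGHD, censorship gives complete 𝓘⁺, X₁ an honest C⁰ decomposition, the third law
an honest C⁰ decomposition with sub-extremal holes, and U the honest sub-extremal C² decomposition of the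
Statement's settling clause. (The relative form of `GlobalAttraction.closes`; `KerrEnded` is unfolded to
`HasExactKerrEnd` by `InitialDataSet.hasExactKerrEnd_iff`, which is `Iff.rfl`.) -/
theorem SettlingAlongCensoredKerrEnds_of_stubs :
    (∀ (X : Type) [TopologicalSpace X] [ChartedSpace E3 X] [IsManifold (𝓡 3) ∞ X] [T2Space X]
      [SecondCountableTopology X] [ConnectedSpace X],
      ∀ D ∈ admissibleVacuumData X, D.HasExactKerrEnd →
        ∀ 𝒟 : VacuumCauchyDevelopment D, 𝒟.IsMaximal →
          Summit.FinalStateConjecture.HasCompleteNullInfinity 𝒟.toCauchyDevelopment →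
            ∃ (O : Set 𝒟.carrier) (d : FinalStateDecomposition 𝒟.toSpacetime O 0),
              O = Summit.FinalStateConjecture.exteriorOf 𝒟.toCauchyDevelopment d.charted ∧
                Summit.FinalStateConjecture.RaysStayInClosure 𝒟.toCauchyDevelopment O ∧
                  Summit.FinalStateConjecture.HasExhaustiveCharts d ∧
                    Summit.FinalStateConjecture.IsFutureOriented d) →
    (∀ (X : Type) [TopologicalSpace X] [ChartedSpace E3 X] [IsManifold (𝓡 3) ∞ X] [T2Space X]
      [SecondCountableTopology X] [ConnectedSpace X],
      ∀ (e : AFEnd X) (F : EuclideanSpace ℝ (Fin 1) → InitialDataSet (𝓡 3) X),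
        InitialDataSet.IsTameDataFamily e 1 F →
          ((InitialDataSet.IsImmersedAtZero 1 F ∧ Injective F) ∨ ∀ c, F c = F 0) →
            (∀ c, F c ∈ admissibleVacuumData X) →
              (∀ c ≠ 0, (F c).HasExactKerrEnd ∧
                ∀ 𝒟 : VacuumCauchyDevelopment (F c), 𝒟.IsMaximal →
                  Summit.FinalStateConjecture.HasCompleteNullInfinity 𝒟.toCauchyDevelopment) →
                ∃ (e' : AFEnd X) (F' : EuclideanSpace ℝ (Fin 1) → InitialDataSet (𝓡 3) X),
                  InitialDataSet.IsTameDataFamily e' 1 F' ∧ F' 0 = F 0 ∧ Injective F' ∧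
                    InitialDataSet.IsImmersedAtZero 1 F' ∧
                    (∀ c, F' c ∈ admissibleVacuumData X) ∧
                    ∀ c ≠ 0, (F' c).HasExactKerrEnd ∧
                      (∀ 𝒟 : VacuumCauchyDevelopment (F' c), 𝒟.IsMaximal →
                        Summit.FinalStateConjecture.HasCompleteNullInfinity 𝒟.toCauchyDevelopment) ∧
                      ∀ 𝒟 : VacuumCauchyDevelopment (F' c), 𝒟.IsMaximal →
                        (∃ (O : Set 𝒟.carrier) (d : FinalStateDecomposition 𝒟.toSpacetime O 0),
                          O = Summit.FinalStateConjecture.exteriorOf 𝒟.toCauchyDevelopment d.charted ∧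
                            Summit.FinalStateConjecture.RaysStayInClosure 𝒟.toCauchyDevelopment O ∧
                              Summit.FinalStateConjecture.HasExhaustiveCharts d ∧
                                Summit.FinalStateConjecture.IsFutureOriented d) →
                          ∃ (O : Set 𝒟.carrier) (d : FinalStateDecomposition 𝒟.toSpacetime O 0),
                            (∀ i, Kerr.IsSubextremal (d.mass i) (d.spin i)) ∧
                            O = Summit.FinalStateConjecture.exteriorOf 𝒟.toCauchyDevelopment d.charted ∧
                              Summit.FinalStateConjecture.RaysStayInClosure 𝒟.toCauchyDevelopment O ∧
                                Summit.FinalStateConjecture.HasExhaustiveCharts d ∧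
                                  Summit.FinalStateConjecture.IsFutureOriented d) →
    (∀ (X : Type) [TopologicalSpace X] [ChartedSpace E3 X] [IsManifold (𝓡 3) ∞ X] [T2Space X]
      [SecondCountableTopology X] [ConnectedSpace X],
      ∀ D ∈ admissibleVacuumData X, D.HasExactKerrEnd →
        ∀ 𝒟 : VacuumCauchyDevelopment D, 𝒟.IsMaximal →
          Summit.FinalStateConjecture.HasCompleteNullInfinity 𝒟.toCauchyDevelopment →
            ∀ (O : Set 𝒟.carrier) (d₀ : FinalStateDecomposition 𝒟.toSpacetime O 0),
              O = Summit.FinalStateConjecture.exteriorOf 𝒟.toCauchyDevelopment d₀.charted →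
                Summit.FinalStateConjecture.RaysStayInClosure 𝒟.toCauchyDevelopment O →
                  Summit.FinalStateConjecture.HasExhaustiveCharts d₀ →
                    Summit.FinalStateConjecture.IsFutureOriented d₀ →
                      (∀ i, Kerr.IsSubextremal (d₀.mass i) (d₀.spin i)) →
                        ∃ (O' : Set 𝒟.carrier) (d : FinalStateDecomposition 𝒟.toSpacetime O' 2),
                          (∀ i, Kerr.IsSubextremal (d.mass i) (d.spin i)) ∧
                            O' = Summit.FinalStateConjecture.exteriorOf 𝒟.toCauchyDevelopment d.charted ∧
                              Summit.FinalStateConjecture.RaysStayInClosure 𝒟.toCauchyDevelopment O' ∧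
                                Summit.FinalStateConjecture.HasExhaustiveCharts d ∧
                                  Summit.FinalStateConjecture.IsFutureOriented d) →
    Summit.FinalStateConjecture.FinalStateConjecture.Theses.ExactKerrEnds.SettlingAlongCensoredKerrEnds := by
  intro h₁ hK hU X _ _ _ _ _ _ KerrEnded Censored Settled e F hF hdich h𝓓 hQ
  -- the members off `0` of `F` are Kerr-ended (legend = `HasExactKerrEnd`, definitionally) and censored
  have hQ' : ∀ c ≠ 0, (F c).HasExactKerrEnd ∧
      ∀ 𝒟 : VacuumCauchyDevelopment (F c), 𝒟.IsMaximal →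
        Summit.FinalStateConjecture.HasCompleteNullInfinity 𝒟.toCauchyDevelopment := fun c hc ↦
    ⟨(InitialDataSet.hasExactKerrEnd_iff (F c)).2 (hQ c hc).1, (hQ c hc).2⟩
  -- the kick: a tame injective immersed admissible curve through `F 0` of Kerr-ended, censored,
  -- third-law data
  obtain ⟨e', F', hF', hF'0, hinj, himm, h𝓓', hP⟩ := hK X e F hF hdich h𝓓 hQ'
  refine ⟨e', F', hF', hF'0, hinj, himm, h𝓓', fun c hc 𝒟 hmax ↦ ?_⟩
  obtain ⟨hKE, hCen, hTL⟩ := hP c hc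
  -- complete 𝓘⁺ from censorship
  have hscri : Summit.FinalStateConjecture.HasCompleteNullInfinity 𝒟.toCauchyDevelopment := hCen 𝒟 hmax
  refine ⟨hscri, ?_⟩
  -- an honest C⁰ decomposition from X₁, a sub-extremal one from the third law, the C² one from U
  obtain ⟨O₀, d₀, hO₀, hR₀, hE₀, hFO₀⟩ := h₁ X (F' c) (h𝓓' c) hKE 𝒟 hmax hscri
  obtain ⟨O, d₁, hsub₁, hO, hR, hE, hFO⟩ := hTL 𝒟 hmax ⟨O₀, d₀, hO₀, hR₀, hE₀, hFO₀⟩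
  obtain ⟨O', d, hsub, hO', hR', hE', hFO'⟩ :=
    hU X (F' c) (h𝓓' c) hKE 𝒟 hmax hscri O d₁ hO hR hE hFO hsub₁
  exact ⟨O', d, hsub, hO', hR', hE', hFO'⟩

/-- **The line concludes the crux BY NAME**: `SettlingAlongCensoredKerrEnds` from the three registered
stubs `stub_kerrEndedCensoredSettleC0` (X₁), `stub_thirdLawKickAlongCensoredKerrEnds` (K),
`stub_kerrEndedRedshiftUpgrade` (U), discharged inside the proof (the only `sorry`s are the stubs'). -/
theorem SettlingAlongCensoredKerrEnds_of :
    Summit.FinalStateConjecture.FinalStateConjecture.Theses.ExactKerrEnds.SettlingAlongCensoredKerrEnds :=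
  SettlingAlongCensoredKerrEnds_of_stubs stub_kerrEndedCensoredSettleC0
    stub_thirdLawKickAlongCensoredKerrEnds stub_kerrEndedRedshiftUpgrade

end Summit.FinalStateConjecture.FinalStateConjecture.Cruxes.SettlingAlongCensoredKerrEnds.KerrEndedAttraction

end
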